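import Summits.Ventures.LatticeQCDFlow.Exactness.Phi4LocalMetropolisReversible
import Summits.Ventures.LatticeQCDFlow.Exactness.FlowSamplerPositive
import HarnessLib

/-!
# Random-walk Metropolis with a POSITIVE-DEFINITE step law is a positive operator on `L²(w)` (the line; Rudolf–Ullrich by layer cake)

HONEST FRAMING: exact (Metropolis-corrected) sampling algorithms for lattice gauge theory;
figures of merit are autocorrelation/cost numbers at stated couplings and volumes; no
continuum-physics claim.  (SCALAR calibration rung S0-A: not a gauge result.)

Venture `LatticeQCDFlow` (cell pub-lqcd), topic `Exactness`; FANOUT row 2 (`s0-phi4`, LOCAL arm).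
NEW WORK of the cell over Mathlib and row 2's line lemmas (`metroFlow`, `accept_mul_weight`,
`metropolis_line_pair` of `Exactness/Phi4LocalMetropolis{Exact,Reversible}.lean`) and the layer-cake
lemmas of `Exactness/FlowSamplerPositive.lean` (`ite_lt_mul_ite_lt`, `integral_Ioi_ite_lt`).
Nothing is cited as a fact.  Printed counterpart NAMED ONLY: Rudolf–Ullrich 2013, *Positivity of
hit-and-run and related algorithms*, Electron. Commun. Probab. 18 no. 49, §3.4 Lemma 3.1: the
Metropolis algorithm with a positive proposal (reversible w.r.t. the reference measure, positive on
its `L²`) induces a positive Markov operator — there for targets on a bounded `K ⊂ ℝ^d` via the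
slice-sampler representation; here on the real line with Lebesgue reference measure, an integrable
weight `w > 0` and a step law `ρ` that is POSITIVE DEFINITE in the integrated sense
(`0 ≤ ∫∫ G(t) G(t') ρ(t' − t)` for bounded integrable `G`), by the layer cake
`min(w t, w t') = ∫_{u>0} 1[u < w t] 1[u < w t'] du` and Fubini; this is the one-dimensional core of the
lattice theorem (`Exactness/Phi4MetropolisPositive.lean`: the random-site Metropolis scan of lattice
φ⁴ with Gaussian steps is a positive operator).  Which step laws are positive definite
(symmetric convolution squares, the Gaussian) is `Exactness/ConvolutionSquarePosDef.lean`.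

## What is proved (section `Line`; `w > 0` measurable integrable, `ρ ≥ 0` measurable with `∫ρ = 1`,
`g` measurable with `|g| ≤ B`; `s(t,t') = min(w t, w t') ρ(t' − t) = metroFlow w ρ t t'`)

* `integrable_cutoff` — the cut-off observable `c_u = 1[u < w]·g` is integrable for `u > 0`;
  `integrable_shear` — `(t,t') ↦ f(t) b(t') ρ(t'−t)` is integrable for integrable `f`, bounded `b`;
* **`integral_integral_metroFlow_eq_layerCake`** —
  `∫∫ s(t,t') g(t') g(t) = ∫_{u>0} (∫∫ c_u(t) c_u(t') ρ(t'−t)) du` (triple Fubini);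
* **`integral_integral_metroFlow_nonneg`** — hence `≥ 0` when `ρ` is positive definite;
* **`metropolis_line_positive`** — `0 ≤ ∫ g (K g) w`, where
  `(K g)(t) = ∫ [min(1, w t'/w t) g(t') + (1 − min(1, w t'/w t)) g(t)] ρ(t'−t) dt'`: the off-diagonal
  part is the layer-cake square integral, the rejected mass contributes `∫ g² w·(1 − acc) ≥ 0`.

NOT CLAIMED: positivity for step laws that are not positive definite (the uniform window
`U[−δ, δ]` is not: its Fourier transform changes sign); evenness of `ρ` is not needed here.
-/

namespace Summit.Ventures.LatticeQCDFlow.Exactness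

open Real MeasureTheory Filter Set

section Line

/-! ## §1 Cut-offs and sheared products -/

/-- The cut-off observable `c_u = 1[u < w]·g` is bounded by the bound of `g`. -/
theorem abs_cutoff_le {w g : ℝ → ℝ} {B : ℝ} (hgb : ∀ t, |g t| ≤ B) (u t : ℝ) :
    |(if u < w t then g t else 0)| ≤ B := by
  split_ifs
  · exact hgb t
  · rw [abs_zero]; exact (abs_nonneg _).trans (hgb t)

/-- For `u > 0` the cut-off observable is integrable (`|c_u| ≤ (B/u)·w`). -/
theorem integrable_cutoff {w g : ℝ → ℝ} (hw0 : ∀ t, 0 < w t) (hwm : Measurable w)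
    (hwi : Integrable w) (hgm : Measurable g) {B : ℝ} (hgb : ∀ t, |g t| ≤ B) {u : ℝ} (hu : 0 < u) :
    Integrable (fun t => if u < w t then g t else 0) := by
  have hB : 0 ≤ B := (abs_nonneg _).trans (hgb 0)
  refine Integrable.mono' (hwi.const_mul (B / u))
    (Measurable.ite (measurableSet_lt measurable_const hwm) hgm measurable_const).aestronglyMeasurable
    (Eventually.of_forall fun t => ?_)
  rw [Real.norm_eq_abs]
  split_ifs with h
  · calc |g t| ≤ B := hgb t
      _ = B / u * u := by field_simp
      _ ≤ B / u * w t := mul_le_mul_of_nonneg_left h.le (div_nonneg hB hu.le)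
  · rw [abs_zero]; exact mul_nonneg (div_nonneg hB hu.le) (hw0 t).le

/-- **Sheared products are integrable on the plane**: `(t, t') ↦ f(t) b(t') ρ(t' − t)` for
integrable `f`, bounded measurable `b` and an integrable step law `ρ ≥ 0`. -/
theorem integrable_shear {f b ρ : ℝ → ℝ} (hfm : Measurable f) (hfi : Integrable f)
    (hbm : Measurable b) {C : ℝ} (hbb : ∀ t, |b t| ≤ C) (hρ0 : ∀ u, 0 ≤ ρ u) (hρm : Measurable ρ)
    (hρi : Integrable ρ) :
    Integrable (fun p : ℝ × ℝ => f p.1 * b p.2 * ρ (p.2 - p.1)) ((volume : Measure ℝ).prod volume) := by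
  have hC : 0 ≤ C := (abs_nonneg _).trans (hbb 0)
  have hm : Measurable fun p : ℝ × ℝ => f p.1 * b p.2 * ρ (p.2 - p.1) :=
    ((hfm.comp measurable_fst).mul (hbm.comp measurable_snd)).mul
      (hρm.comp (measurable_snd.sub measurable_fst))
  rw [integrable_prod_iff hm.aestronglyMeasurable]
  have hsec : ∀ t, Integrable (fun t' => f t * b t' * ρ (t' - t)) := by
    intro t
    refine Integrable.mono' ((hρi.comp_sub_right t).const_mul (|f t| * C))
      (((measurable_const.mul hbm).mul (hρm.comp (measurable_id.sub_const t))).aestronglyMeasurable)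
      (Eventually.of_forall fun t' => ?_)
    rw [Real.norm_eq_abs, abs_mul, abs_mul, abs_of_nonneg (hρ0 _)]
    gcongr
    · exact hρ0 _
    · exact hbb t'
  constructor
  · exact Eventually.of_forall hsec
  · refine Integrable.mono' (hfi.norm.mul_const (C * ∫ u, ρ u))
      hm.aestronglyMeasurable.norm.integral_prod_right' (Eventually.of_forall fun t => ?_)
    rw [Real.norm_eq_abs, abs_of_nonneg (integral_nonneg fun t' => norm_nonneg _), Real.norm_eq_abs]
    calc ∫ t', ‖f t * b t' * ρ (t' - t)‖
        ≤ ∫ t', |f t| * C * ρ (t' - t) := by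
          refine integral_mono (hsec t).norm ((hρi.comp_sub_right t).const_mul _) fun t' => ?_
          dsimp only
          rw [Real.norm_eq_abs, abs_mul, abs_mul, abs_of_nonneg (hρ0 _)]
          gcongr
          · exact hρ0 _
          · exact hbb t'
      _ = |f t| * (C * ∫ u, ρ u) := by
          rw [integral_const_mul, integral_sub_right_eq_self (μ := (volume : Measure ℝ)) ρ t]
          ring

/-! ## §2 The off-diagonal form is a layer-cake integral of sheared squares -/

/-- **LAYER CAKE FOR THE METROPOLIS FLOW (triple Fubini).**  With the cut-offs
`c_u(t) = 1[u < w t] g(t)`: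
`∫∫ s(t,t') g(t') g(t) dt' dt = ∫_{u>0} (∫∫ c_u(t) c_u(t') ρ(t'−t) dt' dt) du`. -/
theorem integral_integral_metroFlow_eq_layerCake {w ρ g : ℝ → ℝ} (hw0 : ∀ t, 0 < w t)
    (hwm : Measurable w) (hwi : Integrable w) (hρ0 : ∀ u, 0 ≤ ρ u) (hρm : Measurable ρ)
    (hρi : Integrable ρ) (hρ1 : ∫ u, ρ u = 1) (hgm : Measurable g) {B : ℝ} (hgb : ∀ t, |g t| ≤ B) :
    ∫ t, ∫ t', metroFlow w ρ t t' * g t' * g t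
      = ∫ u in Ioi (0:ℝ), ∫ t, ∫ t', (if u < w t then g t else 0) * (if u < w t' then g t' else 0)
          * ρ (t' - t) := by
  set ν : Measure ℝ := volume.restrict (Ioi 0) with hν
  set c : ℝ → ℝ → ℝ := fun u t => if u < w t then g t else 0 with hc
  have hB : 0 ≤ B := (abs_nonneg _).trans (hgb 0)
  have hcm : Measurable fun z : ℝ × ℝ => c z.2 z.1 := by
    simp only [hc]
    exact Measurable.ite (measurableSet_lt measurable_snd (hwm.comp measurable_fst))
      (hgm.comp measurable_fst) measurable_const
  -- the integrand on `(ℝ × ℝ) × ℝ`: `F((t,t'),u) = c_u(t) c_u(t') ρ(t'−t)`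
  have hFm : Measurable fun z : (ℝ × ℝ) × ℝ => c z.2 z.1.1 * c z.2 z.1.2 * ρ (z.1.2 - z.1.1) :=
    ((hcm.comp ((measurable_fst.comp measurable_fst).prodMk measurable_snd)).mul
      (hcm.comp ((measurable_snd.comp measurable_fst).prodMk measurable_snd))).mul
      (hρm.comp ((measurable_snd.comp measurable_fst).sub (measurable_fst.comp measurable_fst)))
  have hprod_eq : ∀ (u t t' : ℝ), c u t * c u t' * ρ (t' - t)
      = if u < min (w t) (w t') then g t * g t' * ρ (t' - t) else 0 := by
    intro u t t'
    simp only [hc]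
    rw [ite_lt_mul_ite_lt u (w t) (w t') (g t) (g t')]
    split_ifs <;> simp
  have hmin0 : ∀ t t', 0 ≤ min (w t) (w t') := fun t t' => le_min (hw0 t).le (hw0 t').le
  have hF_eq : ∀ t t', ∫ u, c u t * c u t' * ρ (t' - t) ∂ν = metroFlow w ρ t t' * g t' * g t := by
    intro t t'
    simp_rw [hprod_eq]
    rw [hν, integral_Ioi_ite_lt (hmin0 t t')]
    unfold metroFlow
    ring
  have hnorm_eq : ∀ t t', ∫ u, ‖c u t * c u t' * ρ (t' - t)‖ ∂ν
      = min (w t) (w t') * (|g t| * |g t'| * ρ (t' - t)) := by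
    intro t t'
    have e : ∀ u, ‖c u t * c u t' * ρ (t' - t)‖
        = if u < min (w t) (w t') then |g t| * |g t'| * ρ (t' - t) else 0 := by
      intro u
      rw [hprod_eq, Real.norm_eq_abs]
      split_ifs
      · rw [abs_mul, abs_mul, abs_of_nonneg (hρ0 _)]
      · exact abs_zero
    simp_rw [e]
    rw [hν, integral_Ioi_ite_lt (hmin0 t t')]
  -- integrability on the triple product
  have hG := integrable_weight_mul_proposal hwm hwi (fun t => (hw0 t).le) hρm hρi hρ0 hρ1
  have hFint : Integrable (fun z : (ℝ × ℝ) × ℝ => c z.2 z.1.1 * c z.2 z.1.2 * ρ (z.1.2 - z.1.1))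
      (((volume : Measure ℝ).prod volume).prod ν) := by
    rw [integrable_prod_iff hFm.aestronglyMeasurable]
    constructor
    · refine Eventually.of_forall fun p => ?_
      have e : (fun u => c u p.1 * c u p.2 * ρ (p.2 - p.1))
          = (Iio (min (w p.1) (w p.2))).indicator (fun _ => g p.1 * g p.2 * ρ (p.2 - p.1)) := by
        funext u
        rw [hprod_eq]
        simp only [Set.indicator, Set.mem_Iio]
      rw [e, integrable_indicator_iff measurableSet_Iio]
      refine integrableOn_const ?_
      rw [hν, Measure.restrict_apply measurableSet_Iio, Iio_inter_Ioi, Real.volume_Ioo]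
      exact ENNReal.ofReal_ne_top
    · have e : (fun p : ℝ × ℝ => ∫ u, ‖c u p.1 * c u p.2 * ρ (p.2 - p.1)‖ ∂ν)
          = fun p => min (w p.1) (w p.2) * (|g p.1| * |g p.2| * ρ (p.2 - p.1)) := by
        funext p
        exact hnorm_eq p.1 p.2
      rw [e]
      refine Integrable.mono' (hG.const_mul (B * B))
        ((((hwm.comp measurable_fst).min (hwm.comp measurable_snd)).mul
          (((continuous_abs.measurable.comp (hgm.comp measurable_fst)).mul
            (continuous_abs.measurable.comp (hgm.comp measurable_snd))).mul
            (hρm.comp (measurable_snd.sub measurable_fst)))).aestronglyMeasurable)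
        (Eventually.of_forall fun p => ?_)
      rw [Real.norm_eq_abs, abs_of_nonneg (mul_nonneg (hmin0 p.1 p.2) (mul_nonneg
        (mul_nonneg (abs_nonneg _) (abs_nonneg _)) (hρ0 _)))]
      calc min (w p.1) (w p.2) * (|g p.1| * |g p.2| * ρ (p.2 - p.1))
          ≤ w p.1 * (B * B * ρ (p.2 - p.1)) := by
            refine mul_le_mul (min_le_left _ _) ?_ (mul_nonneg (mul_nonneg (abs_nonneg _)
              (abs_nonneg _)) (hρ0 _)) (hw0 p.1).le
            gcongr
            · exact hρ0 _
            · exact hgb _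
            · exact hgb _
        _ = B * B * (w p.1 * ρ (p.2 - p.1)) := by ring
  -- Fubini
  calc ∫ t, ∫ t', metroFlow w ρ t t' * g t' * g t
      = ∫ t, ∫ t', ∫ u, c u t * c u t' * ρ (t' - t) ∂ν := by
        simp_rw [hF_eq]
    _ = ∫ p, ∫ u, c u p.1 * c u p.2 * ρ (p.2 - p.1) ∂ν ∂((volume : Measure ℝ).prod volume) :=
        (integral_prod (fun p : ℝ × ℝ => ∫ u, c u p.1 * c u p.2 * ρ (p.2 - p.1) ∂ν)
          hFint.integral_prod_left).symm
    _ = ∫ u, ∫ p, c u p.1 * c u p.2 * ρ (p.2 - p.1) ∂((volume : Measure ℝ).prod volume) ∂ν :=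
        integral_integral_swap
          (f := fun (p : ℝ × ℝ) (u : ℝ) => c u p.1 * c u p.2 * ρ (p.2 - p.1)) hFint
    _ = ∫ u, (∫ t, ∫ t', (if u < w t then g t else 0) * (if u < w t' then g t' else 0)
          * ρ (t' - t)) ∂ν := by
        rw [hν]
        refine setIntegral_congr_fun (measurableSet_Ioi (a := (0:ℝ))) fun u hu => ?_
        have hcum : Measurable fun t => if u < w t then g t else 0 :=
          Measurable.ite (measurableSet_lt measurable_const hwm) hgm measurable_const
        have h := integral_prod (μ := (volume : Measure ℝ)) (ν := (volume : Measure ℝ))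
          (fun p : ℝ × ℝ => (if u < w p.1 then g p.1 else 0) * (if u < w p.2 then g p.2 else 0)
            * ρ (p.2 - p.1))
          (integrable_shear hcum (integrable_cutoff hw0 hwm hwi hgm hgb hu) hcum
            (fun t => abs_cutoff_le hgb u t) hρ0 hρm hρi)
        simp only [hc] at h ⊢
        exact h

/-- **THE OFF-DIAGONAL FORM IS NONNEGATIVE** when the step law is positive definite in the integrated
sense (`0 ≤ ∫∫ G(t) G(t') ρ(t'−t)` for bounded measurable integrable `G`). -/
theorem integral_integral_metroFlow_nonneg {w ρ g : ℝ → ℝ} (hw0 : ∀ t, 0 < w t)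
    (hwm : Measurable w) (hwi : Integrable w) (hρ0 : ∀ u, 0 ≤ ρ u) (hρm : Measurable ρ)
    (hρi : Integrable ρ) (hρ1 : ∫ u, ρ u = 1)
    (hρpd : ∀ ⦃G : ℝ → ℝ⦄, Measurable G → Integrable G → ∀ ⦃C : ℝ⦄, (∀ t, |G t| ≤ C) →
      0 ≤ ∫ t, ∫ t', G t * G t' * ρ (t' - t))
    (hgm : Measurable g) {B : ℝ} (hgb : ∀ t, |g t| ≤ B) :
    0 ≤ ∫ t, ∫ t', metroFlow w ρ t t' * g t' * g t := by
  rw [integral_integral_metroFlow_eq_layerCake hw0 hwm hwi hρ0 hρm hρi hρ1 hgm hgb]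
  refine setIntegral_nonneg measurableSet_Ioi fun u hu => ?_
  exact hρpd (Measurable.ite (measurableSet_lt measurable_const hwm) hgm measurable_const)
    (integrable_cutoff hw0 hwm hwi hgm hgb hu) (fun t => abs_cutoff_le hgb u t)

/-! ## §3 The Metropolis operator on the line is positive -/

/-- **RANDOM-WALK METROPOLIS WITH A POSITIVE-DEFINITE STEP LAW IS A POSITIVE OPERATOR ON `L²(w)`.**
For a positive integrable weight `w`, a step law `ρ ≥ 0`, `∫ρ = 1`, positive definite in the
integrated sense, and every bounded measurable `g`:  `0 ≤ ∫ g (K g) w`, where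
`(K g)(t) = ∫ [min(1, w t'/w t) g(t') + (1 − min(1, w t'/w t)) g(t)] ρ(t' − t) dt'`.
The off-diagonal part is `integral_integral_metroFlow_nonneg`; the rejected mass adds
`∫ g² (w − ∫ s(·,t') dt') ≥ 0`. -/
theorem metropolis_line_positive {w ρ g : ℝ → ℝ} (hw0 : ∀ t, 0 < w t) (hwm : Measurable w)
    (hwi : Integrable w) (hρ0 : ∀ u, 0 ≤ ρ u) (hρm : Measurable ρ) (hρi : Integrable ρ)
    (hρ1 : ∫ u, ρ u = 1)
    (hρpd : ∀ ⦃G : ℝ → ℝ⦄, Measurable G → Integrable G → ∀ ⦃C : ℝ⦄, (∀ t, |G t| ≤ C) →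
      0 ≤ ∫ t, ∫ t', G t * G t' * ρ (t' - t))
    (hgm : Measurable g) {B : ℝ} (hgb : ∀ t, |g t| ≤ B) :
    0 ≤ ∫ t, g t * (∫ t', (min 1 (w t' / w t) * g t' + (1 - min 1 (w t' / w t)) * g t)
      * ρ (t' - t)) * w t := by
  have hB : 0 ≤ B := (abs_nonneg _).trans (hgb 0)
  -- pointwise split: off-diagonal flow term + rejected (diagonal) mass
  have hsm : Measurable fun p : ℝ × ℝ => metroFlow w ρ p.1 p.2 := by
    unfold metroFlow
    exact ((hwm.comp measurable_fst).min (hwm.comp measurable_snd)).mul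
      (hρm.comp (measurable_snd.sub measurable_fst))
  have hs0 : ∀ t t', 0 ≤ metroFlow w ρ t t' := fun t t' => by
    unfold metroFlow
    exact mul_nonneg (le_min (hw0 t).le (hw0 t').le) (hρ0 _)
  have hs_le : ∀ t t', metroFlow w ρ t t' ≤ w t * ρ (t' - t) := fun t t' => by
    unfold metroFlow
    exact mul_le_mul_of_nonneg_right (min_le_left _ _) (hρ0 _)
  have hsI : ∀ t, Integrable (fun t' => metroFlow w ρ t t') := fun t =>
    Integrable.mono' ((hρi.comp_sub_right t).const_mul (w t))
      (hsm.comp (measurable_const.prodMk measurable_id)).aestronglyMeasurable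
      (Eventually.of_forall fun t' => by
        rw [Real.norm_eq_abs, abs_of_nonneg (hs0 t t')]
        exact hs_le t t')
  set D : ℝ → ℝ := fun t => w t - ∫ t', metroFlow w ρ t t' with hD
  have hD0 : ∀ t, 0 ≤ D t := by
    intro t
    simp only [hD]
    have h : ∫ t', metroFlow w ρ t t' ≤ ∫ t', w t * ρ (t' - t) :=
      integral_mono (hsI t) ((hρi.comp_sub_right t).const_mul (w t)) fun t' => hs_le t t'
    rw [integral_const_mul, integral_sub_right_eq_self (μ := (volume : Measure ℝ)) ρ t, hρ1,
      mul_one] at h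
    linarith
  have hDle : ∀ t, D t ≤ w t := by
    intro t
    have h0 : 0 ≤ ∫ t', metroFlow w ρ t t' := integral_nonneg fun t' => hs0 t t'
    simp only [hD]
    linarith
  have hDm : Measurable D :=
    hwm.sub (hsm.stronglyMeasurable.integral_prod_right').measurable
  have hL : ∀ t, g t * (∫ t', (min 1 (w t' / w t) * g t' + (1 - min 1 (w t' / w t)) * g t)
      * ρ (t' - t)) * w t = (∫ t', metroFlow w ρ t t' * g t' * g t) + g t ^ 2 * D t := by
    intro t
    have h1 := metropolis_line_pair hw0 hwm hρ0 hρm hρi hρ1 hgm hgb t (g t)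
    have e3 : ∫ t', metroFlow w ρ t t' * g t * g t = (∫ t', metroFlow w ρ t t') * g t * g t := by
      rw [integral_mul_const, integral_mul_const]
    calc g t * (∫ t', (min 1 (w t' / w t) * g t' + (1 - min 1 (w t' / w t)) * g t) * ρ (t' - t))
          * w t
        = (∫ t', (min 1 (w t' / w t) * g t' + (1 - min 1 (w t' / w t)) * g t) * ρ (t' - t))
          * g t * w t := by ring
      _ = (∫ t', metroFlow w ρ t t' * g t' * g t) + g t * g t * w t
          - ∫ t', metroFlow w ρ t t' * g t * g t := h1
      _ = (∫ t', metroFlow w ρ t t' * g t' * g t) + g t ^ 2 * D t := by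
          rw [e3, hD]
          ring
  simp_rw [hL]
  -- both pieces are integrable in `t`
  have hF1 : Integrable (fun p : ℝ × ℝ => metroFlow w ρ p.1 p.2 * g p.2 * g p.1)
      ((volume : Measure ℝ).prod volume) := by
    have hG := integrable_weight_mul_proposal hwm hwi (fun t => (hw0 t).le) hρm hρi hρ0 hρ1
    refine Integrable.mono' (hG.const_mul (B * B))
      ((hsm.mul (hgm.comp measurable_snd)).mul (hgm.comp measurable_fst)).aestronglyMeasurable
      (Eventually.of_forall fun p => ?_)
    rw [Real.norm_eq_abs, abs_mul, abs_mul, abs_of_nonneg (hs0 _ _)]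
    calc metroFlow w ρ p.1 p.2 * |g p.2| * |g p.1| ≤ (w p.1 * ρ (p.2 - p.1)) * B * B :=
          mul_le_mul (mul_le_mul (hs_le _ _) (hgb _) (abs_nonneg _)
            (mul_nonneg (hw0 _).le (hρ0 _))) (hgb _) (abs_nonneg _)
            (mul_nonneg (mul_nonneg (hw0 _).le (hρ0 _)) hB)
      _ = B * B * (w p.1 * ρ (p.2 - p.1)) := by ring
  have hI1 : Integrable (fun t => ∫ t', metroFlow w ρ t t' * g t' * g t) := hF1.integral_prod_left
  have hI2 : Integrable (fun t => g t ^ 2 * D t) := by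
    refine Integrable.mono' (hwi.const_mul (B ^ 2)) ((hgm.pow_const 2).mul hDm).aestronglyMeasurable
      (Eventually.of_forall fun t => ?_)
    rw [Real.norm_eq_abs, abs_mul, abs_of_nonneg (hD0 t), abs_of_nonneg (sq_nonneg _)]
    have hg2 : g t ^ 2 ≤ B ^ 2 := by
      have h := hgb t
      rw [← sq_abs]
      exact pow_le_pow_left₀ (abs_nonneg _) h 2
    exact mul_le_mul hg2 (hDle t) (hD0 t) (sq_nonneg _)
  rw [integral_add hI1 hI2]
  have h1 := integral_integral_metroFlow_nonneg hw0 hwm hwi hρ0 hρm hρi hρ1 hρpd hgm hgb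
  have h2 : 0 ≤ ∫ t, g t ^ 2 * D t := integral_nonneg fun t => mul_nonneg (sq_nonneg _) (hD0 t)
  linarith

end Line

end Summit.Ventures.LatticeQCDFlow.Exactness
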